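import Mathlib
import HarnessLib
import Literature.Probability.MarkovChains.HMCExpDeltaH
import Summits.Ventures.LatticeQCDFlow.Exactness.SUNWilsonHMCForce
import Summits.Ventures.LatticeQCDFlow.Exactness.SUNMultiStepLeapfrogHMCEngine
import Summits.Ventures.LatticeQCDFlow.Exactness.OpenBoundaryWilsonAction
import Summits.Ventures.LatticeQCDFlow.Exactness.CabibboMarinariORSweep
import Summits.Ventures.LatticeQCDFlow.Exactness.GaugeFTHMCCreutz

/-!
# The acceptance gate `⟨e^{−ΔH}⟩ = 1` of the engine's multi-step `SU(N)` HMC is an identity of the kernel: periodic arm with its own Wilson force, open-boundary arm with any increment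

HONEST FRAMING: exact (Metropolis-corrected) sampling algorithms for lattice gauge theory;
figures of merit are autocorrelation/cost numbers at stated couplings and volumes; no
continuum-physics claim.

Venture `LatticeQCDFlow` (cell pub-lqcd), topic `Exactness`, FANOUT row 21 (`su3-base`: arms `E2 = PBC-HMC` and
`OBC-HMC`, the engine `latflow.core.hmc.HMC(f, β, 'leapfrog').trajectory(τ, nstep)` on `SU(3)`; the row's acceptance item
(h) is the run check "`⟨e^{−ΔH}⟩ = 1 ± 2σ`, reversibility event, `P_acc`" over the production trajectories).  NEW WORK of the
cell over the tree (row 9's `SUNMultiStepLeapfrogHMC`: the `n`-step proposal `sunLeapfrogProposalN` = `flip ∘ (K D K)ⁿ`, an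
involution preserving `Haar^{⊗links} ⊗ μ^{⊗links}` — `measurePreserving_sunLeapfrogProposalN`; `SUNLeapfrogHMCEngine`: the
engine's coordinates `sunCoordι`, kinetic term `sunKinetic` with `Z_T < ∞` (`sumMomentumWeight_sunKinetic_ne_top`),
`sunMomentumWeight` / `sunMomentumLaw`; row 21's `SUNWilsonHMCForce` (the force of record, `measurable_sunWilsonForce`) and
`OpenBoundaryWilsonAction` (`obcAction`); row 14's `GaugeFTHMCCreutz.partitionFn_prod_pos`; the Literature fact
`HMC.integral_exp_neg_deltaH` [MontvayMunster1994 §7.6 (7.238); Creutz 1988]: for every `vol`-preserving map `T` and the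
`H`-Boltzmann law, `⟨e^{−(H∘T − H)}⟩ = 1`).  Row 14 typed this for FIELD-TRANSFORMED HMC on abstract rungs and U(1); the
engine's plain `SU(N)` multi-step kernel with ITS OWN momenta (`𝔰𝔲(N)` coordinates, additive Haar measure, `−tr P²`-type
kinetic term) was not instantiated.  Def-free; nothing is cited as a fact beyond the Literature import; no number.

## What is proved (`G = SU(N)`, links indexed by any finite type, `ε` real, `n` natural, `μ` any additive Haar measure on
## the coordinate space `SUNCoords N` — the engine: Lebesgue in its coordinates)

* `integrable_exp_neg_sunKinetic` — `e^{−T}` is integrable for `μ^{⊗links}` (`Z_T < ∞` restated as integrability).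
* **`sun_leapfrogN_creutz`** — for ANY measurable increment `g` and ANY measurable action `S` with `e^{−S}` integrable for
  product Haar: with `Ψ = sunLeapfrogProposalN (sunCoordι N) _ ε g n` and `H(U, p) = S(U) + T(p)`,
  `∫ e^{−(H(Ψ z) − H z)} dBoltzmann_H(z) = 1` EXACTLY — whatever the step size, the number of steps and the force.
* **`boltzmann_eq_gibbs_prod_momentumLaw`** — the `H`-Boltzmann law of the extended phase space IS the product of the
  configuration target `Z_S⁻¹ e^{−S}·Haar^⊗` (`gibbsProbability`) and the engine's momentum refresh law `Z_T⁻¹e^{−T}·μ^⊗`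
  (`sunMomentumLaw`): "in equilibrium, with freshly drawn momenta" — the state in which the production run evaluates (h).
* **`wilsonForce_sunLeapfrogN_creutz`** — the periodic arm AS RUN: `S = β·S_W` (`suRep N`, torus `(ℤ/L)^d`), increment
  `−(ε/2)·sunWilsonForce N β`: `⟨e^{−ΔH}⟩ = 1` for every `β, ε, n, L`.
* **`obc_sunLeapfrogN_creutz`** — the open-boundary arm: `S = β·S_OBC` (any time direction `τ`), ANY measurable increment
  (in particular the engine's weighted force): `⟨e^{−ΔH}⟩ = 1`.
So a measured `⟨e^{−ΔH}⟩ ≠ 1` beyond errors indicts the implementation (reversibility, area preservation, the energy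
bookkeeping), never the step size: the identity holds for every `ε` and `n`, accurate integrator or not.
NOT CLAIMED: the size of `ΔH` or of `P_acc` (integrator accuracy — measured); `⟨ΔH⟩ ≥ 0` (the Literature's
`integral_deltaH_nonneg` applies verbatim once `ΔH` is integrable — not restated); anything in floating point; `σ` of the test.
-/

noncomputable section

namespace Summit.Ventures.LatticeQCDFlow.Exactness

open MeasureTheory Set Function
open Literature.Probability.MarkovChains.HMC (partitionFn boltzmann integral_exp_neg_deltaH)
open Literature.MathematicalPhysics.QuantumFieldTheory
open scoped ENNReal

set_option backward.isDefEq.respectTransparency false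

/-! ## §1 The momentum weight is integrable -/

section Momentum

variable (N : ℕ) {L : Type*} [Fintype L] (μ : Measure (SUNCoords N)) [μ.IsAddHaarMeasure]

/-- **`e^{−T}` is `μ^{⊗links}`-integrable** for the engine's kinetic term (`Z_T < ∞`). -/
theorem integrable_exp_neg_sunKinetic :
    Integrable (fun p : L → SUNCoords N => Real.exp (-sunKinetic N p)) (Measure.pi fun _ : L => μ) := by
  refine ⟨(Real.measurable_exp.comp (measurable_sunKinetic (L := L) N).neg).aestronglyMeasurable, ?_⟩
  rw [hasFiniteIntegral_iff_ofReal (ae_of_all _ fun p => (Real.exp_pos _).le)]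
  have h := sunMomentumWeight_sunKinetic_ne_top N (L := L) μ
  rw [sunMomentumWeight, withDensity_apply _ MeasurableSet.univ, Measure.restrict_univ] at h
  exact lt_top_iff_ne_top.2 h

/-- `μ^{⊗links}` is not the zero measure (each factor charges the whole space). -/
theorem neZero_pi_sunCoords [SigmaFinite μ] : NeZero (Measure.pi fun _ : L => μ) := by
  refine ⟨fun h => ?_⟩
  have h1 : (Measure.pi fun _ : L => μ) univ = 0 := by rw [h, Measure.coe_zero, Pi.zero_apply]
  rw [← Set.pi_univ (Set.univ : Set L), Measure.pi_pi, Finset.prod_eq_zero_iff] at h1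
  obtain ⟨l, -, hl⟩ := h1
  exact (NeZero.ne (μ univ)) hl

end Momentum

/-! ## §2 Creutz's identity for the engine's `n`-step `SU(N)` proposal -/

section Creutz

variable (N : ℕ) {L : Type*} [Fintype L] (μ : Measure (SUNCoords N)) [μ.IsAddHaarMeasure]

/-- **CREUTZ'S IDENTITY FOR THE ENGINE'S MULTI-STEP `SU(N)` HMC.**  For every measurable momentum increment `g`, every
measurable action `S` with `e^{−S}` integrable for product Haar, every step `ε` and every number of steps `n`: with
`Ψ = flip ∘ (K(g) D(e_ε) K(g))ⁿ` the engine's proposal and `H(U, p) = S(U) + T(p)`, the `H`-Boltzmann expectation of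
`e^{−(H∘Ψ − H)}` is exactly `1`. -/
theorem sun_leapfrogN_creutz (ε : ℝ) (n : ℕ)
    {g : (L → Matrix.specialUnitaryGroup (Fin N) ℂ) → L → SUNCoords N} (hg : Measurable g)
    {S : (L → Matrix.specialUnitaryGroup (Fin N) ℂ) → ℝ} (hS : Measurable S)
    (hSi : Integrable (fun U => Real.exp (-S U))
      (Measure.pi fun _ : L => haarProbability (Matrix.specialUnitaryGroup (Fin N) ℂ))) :
    ∫ z, Real.exp (-((S (sunLeapfrogProposalN (sunCoordι N) (sunCoordι_skew N) ε g n z).1 +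
            sunKinetic N (sunLeapfrogProposalN (sunCoordι N) (sunCoordι_skew N) ε g n z).2) -
          (S z.1 + sunKinetic N z.2)))
      ∂(boltzmann ((Measure.pi fun _ : L => haarProbability (Matrix.specialUnitaryGroup (Fin N) ℂ)).prod
          (Measure.pi fun _ : L => μ))
        fun z => S z.1 + sunKinetic N z.2) = 1 := by
  haveI : SigmaFinite μ := inferInstance
  haveI := neZero_pi_sunCoords N (L := L) μ
  have hH : Measurable fun z : (L → Matrix.specialUnitaryGroup (Fin N) ℂ) × (L → SUNCoords N) =>
      S z.1 + sunKinetic N z.2 :=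
    (hS.comp measurable_fst).add ((measurable_sunKinetic (L := L) N).comp measurable_snd)
  have hZ : 0 < partitionFn ((Measure.pi fun _ : L => haarProbability (Matrix.specialUnitaryGroup (Fin N) ℂ)).prod
      (Measure.pi fun _ : L => μ)) (fun z => S z.1 + sunKinetic N z.2) :=
    partitionFn_prod_pos hSi (integrable_exp_neg_sunKinetic N μ)
  have hT := measurePreserving_sunLeapfrogProposalN (sunCoordι N) (sunCoordι_skew N) ε n μ hg
  have h := integral_exp_neg_deltaH (H := fun z => S z.1 + sunKinetic N z.2) hT hH hZ
  exact h

end Creutz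

/-! ## §3 The Boltzmann law of the extended phase space is the target times the momentum refresh law -/

section Product

variable {X Y : Type*} [MeasurableSpace X] [MeasurableSpace Y]

/-- **`Boltzmann_{S+T}(P ⊗ M) = (Z_S⁻¹e^{−S}·P) ⊗ (Z_T⁻¹e^{−T}·M)`** for a probability measure `P`, an s-finite `M`,
measurable `S`, `T` with `e^{−S}`, `e^{−T}` integrable: the canonical law of the extended phase space is the configuration
Gibbs law times the normalised momentum weight. -/
theorem boltzmann_prod_eq (P : Measure X) [IsProbabilityMeasure P] (M : Measure Y) [SFinite M] {S : X → ℝ} {T : Y → ℝ}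
    (hS : Measurable S) (hT : Measurable T) (hSi : Integrable (fun x => Real.exp (-S x)) P)
    (hTi : Integrable (fun y => Real.exp (-T y)) M) :
    boltzmann (P.prod M) (fun z => S z.1 + T z.2) =
      (gibbsProbability P fun x => Real.exp (-S x)).prod
        (((M.withDensity fun y => ENNReal.ofReal (Real.exp (-T y))) univ)⁻¹ •
          M.withDensity fun y => ENNReal.ofReal (Real.exp (-T y))) := by
  -- the two partition functions as lower integrals
  set ZS : ℝ≥0∞ := (P.withDensity fun x => ENNReal.ofReal (Real.exp (-S x))) univ with hZS
  set ZT : ℝ≥0∞ := (M.withDensity fun y => ENNReal.ofReal (Real.exp (-T y))) univ with hZT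
  have hZS' : ZS = ∫⁻ x, ENNReal.ofReal (Real.exp (-S x)) ∂P := by
    rw [hZS, withDensity_apply _ MeasurableSet.univ, Measure.restrict_univ]
  have hZT' : ZT = ∫⁻ y, ENNReal.ofReal (Real.exp (-T y)) ∂M := by
    rw [hZT, withDensity_apply _ MeasurableSet.univ, Measure.restrict_univ]
  have hfS : Measurable fun x => ENNReal.ofReal (Real.exp (-S x)) := (hS.neg.exp).ennreal_ofReal
  have hfT : Measurable fun y => ENNReal.ofReal (Real.exp (-T y)) := (hT.neg.exp).ennreal_ofReal
  have hZS0 : ZS ≠ 0 := by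
    rw [hZS']
    intro h0
    have := (lintegral_eq_zero_iff hfS).1 h0
    have hpos : 0 < ∫ x, Real.exp (-S x) ∂P := integral_exp_pos hSi
    have hzero : ∫ x, Real.exp (-S x) ∂P = 0 := by
      refine integral_eq_zero_of_ae (this.mono fun x hx => ?_)
      have hx' : ENNReal.ofReal (Real.exp (-S x)) = 0 := hx
      exact absurd (ENNReal.ofReal_eq_zero.1 hx') (not_le.2 (Real.exp_pos _))
    linarith
  have hZStop : ZS ≠ ⊤ := by
    rw [hZS', ← ofReal_integral_eq_lintegral_ofReal hSi (ae_of_all _ fun x => (Real.exp_pos _).le)]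
    exact ENNReal.ofReal_ne_top
  -- the extended partition function factorises
  have hint : Integrable (fun z : X × Y => Real.exp (-(S z.1 + T z.2))) (P.prod M) := by
    refine (hSi.mul_prod hTi).congr (ae_of_all _ fun z => ?_)
    simp only [neg_add, Real.exp_add]
  have hZ : ENNReal.ofReal (partitionFn (P.prod M) fun z => S z.1 + T z.2) = ZS * ZT := by
    rw [partitionFn, ofReal_integral_eq_lintegral_ofReal hint (ae_of_all _ fun z => (Real.exp_pos _).le)]
    have hmul : ∀ z : X × Y, ENNReal.ofReal (Real.exp (-(S z.1 + T z.2))) =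
        ENNReal.ofReal (Real.exp (-S z.1)) * ENNReal.ofReal (Real.exp (-T z.2)) := fun z => by
      rw [← ENNReal.ofReal_mul (Real.exp_pos _).le, neg_add, Real.exp_add]
    simp_rw [hmul]
    rw [lintegral_prod_mul hfS.aemeasurable hfT.aemeasurable, hZS', hZT']
  -- the joint density factorises pointwise
  have hdens : ((P.prod M).withDensity fun z : X × Y => ENNReal.ofReal (Real.exp (-(S z.1 + T z.2)))) =
      (P.prod M).withDensity fun z : X × Y => ENNReal.ofReal (Real.exp (-S z.1)) * ENNReal.ofReal (Real.exp (-T z.2)) := by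
    congr 1
    funext z
    rw [← ENNReal.ofReal_mul (Real.exp_pos _).le, neg_add, Real.exp_add]
  -- assemble
  show (ENNReal.ofReal (partitionFn (P.prod M) fun z => S z.1 + T z.2))⁻¹ •
      ((P.prod M).withDensity fun z : X × Y => ENNReal.ofReal (Real.exp (-(S z.1 + T z.2)))) =
    (ZS⁻¹ • P.withDensity fun x => ENNReal.ofReal (Real.exp (-S x))).prod
      (ZT⁻¹ • M.withDensity fun y => ENNReal.ofReal (Real.exp (-T y)))
  rw [hZ, hdens, Measure.prod_smul_left, Measure.prod_smul_right, smul_smul, prod_withDensity hfS hfT,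
    ENNReal.mul_inv (Or.inl hZS0) (Or.inl hZStop)]

variable (N : ℕ) {L : Type*} [Fintype L] (μ : Measure (SUNCoords N)) [μ.IsAddHaarMeasure]

/-- **THE EQUILIBRIUM STATE OF THE TEST**: for the engine's kinetic term the `(S + T)`-Boltzmann law of
`Haar^{⊗links} ⊗ μ^{⊗links}` is `gibbsProbability (Haar^⊗) e^{−S} ⊗ sunMomentumLaw μ T` — the configuration target times
the momentum refresh law of the kernel `sunLeapfrogHMCN`. -/
theorem boltzmann_eq_gibbs_prod_momentumLaw {S : (L → Matrix.specialUnitaryGroup (Fin N) ℂ) → ℝ} (hS : Measurable S)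
    (hSi : Integrable (fun U => Real.exp (-S U))
      (Measure.pi fun _ : L => haarProbability (Matrix.specialUnitaryGroup (Fin N) ℂ))) :
    boltzmann ((Measure.pi fun _ : L => haarProbability (Matrix.specialUnitaryGroup (Fin N) ℂ)).prod
        (Measure.pi fun _ : L => μ)) (fun z => S z.1 + sunKinetic N z.2) =
      (gibbsProbability (Measure.pi fun _ : L => haarProbability (Matrix.specialUnitaryGroup (Fin N) ℂ))
          fun U => Real.exp (-S U)).prod (sunMomentumLaw μ (sunKinetic (L := L) N)) := by
  haveI : SigmaFinite μ := inferInstance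
  rw [sunMomentumLaw, sunMomentumWeight]
  exact boltzmann_prod_eq _ _ hS (measurable_sunKinetic (L := L) N) hSi (integrable_exp_neg_sunKinetic N μ)

end Product

/-! ## §4 Row 21's arms: the periodic arm with its own Wilson force, the open-boundary arm -/

section Arms

variable (N : ℕ) {d L : ℕ} [NeZero L] (μ : Measure (SUNCoords N)) [μ.IsAddHaarMeasure]

/-- A bounded action has an integrable Boltzmann weight for product Haar (a probability measure). -/
theorem integrable_exp_neg_of_abs_le {S : GaugeConfig d L (Matrix.specialUnitaryGroup (Fin N) ℂ) → ℝ}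
    (hS : Measurable S) {s : ℝ} (hs : ∀ U, |S U| ≤ s) :
    Integrable (fun U => Real.exp (-S U))
      (Measure.pi fun _ : Edge d L => haarProbability (Matrix.specialUnitaryGroup (Fin N) ℂ)) := by
  refine Integrable.mono' (integrable_const (Real.exp s)) (hS.neg.exp).aestronglyMeasurable
    (ae_of_all _ fun U => ?_)
  rw [Real.norm_eq_abs, abs_of_pos (Real.exp_pos _)]
  exact Real.exp_le_exp.2 (by linarith [(abs_le.1 (hs U)).1])

/-- **THE PERIODIC ARM AS RUN (`E2 = PBC-HMC`)**: `S = β·S_W` on the torus `(ℤ/L)^d`, the engine's own half kick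
`−(ε/2)·sunWilsonForce N β`, any `n`: `⟨e^{−ΔH}⟩ = 1` exactly in equilibrium, for every `β`, `ε`, `n`, `L`. -/
theorem wilsonForce_sunLeapfrogN_creutz (β ε : ℝ) (n : ℕ) :
    ∫ z, Real.exp (-((β * wilsonAction (suRep N)
              (sunLeapfrogProposalN (sunCoordι N) (sunCoordι_skew N) ε
                (fun U : GaugeConfig d L (Matrix.specialUnitaryGroup (Fin N) ℂ) => -(ε / 2) • sunWilsonForce N β U) n z).1 +
            sunKinetic N (sunLeapfrogProposalN (sunCoordι N) (sunCoordι_skew N) ε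
                (fun U : GaugeConfig d L (Matrix.specialUnitaryGroup (Fin N) ℂ) => -(ε / 2) • sunWilsonForce N β U) n z).2) -
          (β * wilsonAction (suRep N) z.1 + sunKinetic N z.2)))
      ∂(boltzmann ((Measure.pi fun _ : Edge d L => haarProbability (Matrix.specialUnitaryGroup (Fin N) ℂ)).prod
          (Measure.pi fun _ : Edge d L => μ))
        fun z => β * wilsonAction (suRep N) z.1 + sunKinetic N z.2) = 1 := by
  obtain ⟨s, hs⟩ := exists_bound_smul_wilsonAction_sun N (d := d) (L := L) (suRep N) continuous_suRep β
  have hSm : Measurable fun U : GaugeConfig d L (Matrix.specialUnitaryGroup (Fin N) ℂ) => β * wilsonAction (suRep N) U :=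
    (continuous_smul_wilsonAction (suRep N) continuous_suRep β).measurable
  have h := sun_leapfrogN_creutz N μ ε n
    (g := fun U : GaugeConfig d L (Matrix.specialUnitaryGroup (Fin N) ℂ) => -(ε / 2) • sunWilsonForce N β U)
    (measurable_halfKick_sun N (measurable_sunWilsonForce N (d := d) (L := L) β) ε) hSm
    (integrable_exp_neg_of_abs_le N hSm hs)
  exact h

/-- **THE OPEN-BOUNDARY ARM (`OBC-HMC`)**: `S = β·S_OBC` (time direction `τ`), ANY measurable increment `g` (in particular
the engine's plaquette-weighted force), any `ε`, `n`: `⟨e^{−ΔH}⟩ = 1` exactly in equilibrium. -/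
theorem obc_sunLeapfrogN_creutz (τ : Fin d) (β ε : ℝ) (n : ℕ)
    {g : GaugeConfig d L (Matrix.specialUnitaryGroup (Fin N) ℂ) → Edge d L → SUNCoords N} (hg : Measurable g) :
    ∫ z, Real.exp (-((β * obcAction (suRep N) τ (sunLeapfrogProposalN (sunCoordι N) (sunCoordι_skew N) ε g n z).1 +
            sunKinetic N (sunLeapfrogProposalN (sunCoordι N) (sunCoordι_skew N) ε g n z).2) -
          (β * obcAction (suRep N) τ z.1 + sunKinetic N z.2)))
      ∂(boltzmann ((Measure.pi fun _ : Edge d L => haarProbability (Matrix.specialUnitaryGroup (Fin N) ℂ)).prod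
          (Measure.pi fun _ : Edge d L => μ))
        fun z => β * obcAction (suRep N) τ z.1 + sunKinetic N z.2) = 1 := by
  obtain ⟨s, hs⟩ := exists_bound_smul_obcAction (d := d) (L := L) (suRep N) continuous_suRep τ β
  have hSm : Measurable fun U : GaugeConfig d L (Matrix.specialUnitaryGroup (Fin N) ℂ) => β * obcAction (suRep N) τ U :=
    ((continuous_obcAction (suRep N) continuous_suRep τ).measurable.const_mul β)
  have h := sun_leapfrogN_creutz N μ ε n hg hSm (integrable_exp_neg_of_abs_le N hSm hs)
  exact h

/-- The periodic arm's equilibrium state is `wilsonMeasure (suRep N) β ⊗ sunMomentumLaw`: the Boltzmann law above IS the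
Wilson measure times the momentum refresh law. -/
theorem wilson_boltzmann_eq_wilsonMeasure_prod (β : ℝ) :
    boltzmann ((Measure.pi fun _ : Edge d L => haarProbability (Matrix.specialUnitaryGroup (Fin N) ℂ)).prod
        (Measure.pi fun _ : Edge d L => μ)) (fun z => β * wilsonAction (suRep N) z.1 + sunKinetic N z.2) =
      (wilsonMeasure (d := d) (L := L) (suRep N) β).prod (sunMomentumLaw μ (sunKinetic (L := Edge d L) N)) := by
  obtain ⟨s, hs⟩ := exists_bound_smul_wilsonAction_sun N (d := d) (L := L) (suRep N) continuous_suRep β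
  have hSm : Measurable fun U : GaugeConfig d L (Matrix.specialUnitaryGroup (Fin N) ℂ) => β * wilsonAction (suRep N) U :=
    (continuous_smul_wilsonAction (suRep N) continuous_suRep β).measurable
  rw [boltzmann_eq_gibbs_prod_momentumLaw N μ hSm (integrable_exp_neg_of_abs_le N hSm hs),
    gibbsProbability_smul_wilsonAction_eq N (d := d) (L := L) (suRep N) β]

end Arms

end Summit.Ventures.LatticeQCDFlow.Exactness
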